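import Summits.BirchSwinnertonDyer.BirchSwinnertonDyer.Theorems.ByReductionTypeAtTwoOrdKatoHalfAtTwoIsoColemanHalfClassSemilinear
import Summits.BirchSwinnertonDyer.BirchSwinnertonDyer.Theorems.ByReductionTypeAtTwoOrdKatoHalfAtTwoIsoPosDiscDefs
import HarnessLib

/-!
# Route ByReductionTypeAtTwo, crux `OrdKatoHalfAtTwoIso` (stmt-BirchSwinnertonDyer-19573), child B7′
# (stmt-BirchSwinnertonDyer-23921 `OrdKatoMuPartOptimalAtTwo`): THE COLEMAN HALF-CLASS PACKAGE AT `p = 2`, TYPED —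
# one displayed definition (per datum, `ι`-aware), its instances, and B7′ BY NAME from print + the package at the optimal member

Seat `cruxlead-stmt-BirchSwinnertonDyer-19573-w2` GEN 4 (prover WIDTH under the LEAD lineage `cruxlead-19573`; HOME
`run/shared/lean/pub/bsd-2adic/`; `--supports` stmt-BirchSwinnertonDyer-23921; pen RC-397 (2) / RC-400 (ii)). HONEST FRAMING (cell
bsd-2adic): BSD is not proved by any of this; neither the crux nor B7′ is proved here. ONE DEFINITION of an OPEN per-datum statement,
displayed BY NAME — a memo-tier READING of Kato §§12–17 at `2` (R-B77: beyond-print readings are Summits-side `@[conjecture]`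
definitions consumed by name; nothing is asserted about it, it is NOT a Literature fact) — plus theorems: its `Iff.rfl` unfolding, the
instances that supply it (every Coleman package already in the tree), and the doors of the companion file
`…OrdKatoHalfAtTwoIsoColemanHalfClassSemilinear.lean` re-stated by name. Pattern of the line's binder files p655368 / p678187 / p693557.

THE OBJECT (after GEN 3, pen RC-397 (2): «the ONLY beyond-print content of 23921 is ONE Coleman half-class package at 2»). For one
curve `W`, a weight-2 form `f`, the cyclotomic `(κ, γ)` and dual data `D` (`X = X(E/ℚ_∞)`), `Y` (`X₀`):
`HasColemanHalfClassPackageAtTwo W f κ γ D Y` := there are a ring automorphism `θ` of `Λ = ℤ₂⟦T⟧`, an ideal `P ⊆ Λ` (READING: the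
Coleman image `𝔏(𝐇¹_loc ⧸ 𝐇¹_loc(F⁺T))`, Kato Prop. 17.11), a submodule `M ⊆ P` (READING: the Coleman coordinates `𝔏(loc₂ y)` of
the global Iwasawa classes `y ∈ 𝐇¹_Γ(T₂W)` — Kato's zeta classes `z_γ`, Thm. 16.6, or on a rectangular period lattice (`0 < Δ`)
their HALVES `y = z_γ/2`, lead finding F-27a / p691215), a `θ`-SEMILINEAR column map `τ : P →ₛₗ[θ] X` killing `M` (READING: the
Poitou–Tate map, `ι`-semilinear for the tree's precomposition structure on `D.X` — pen RC-373 (1)/RC-383 «R-b», `θ = ι =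
IwasawaAlgebra.involEquiv 2`; `θ = 1` is the filed linear reading; `θ` ANY automorphism is allowed since `μ` is blind to the keying)
whose image is the kernel of the fine quotient `π : X ↠ X₀` ((14.9.3)/(17.13.1) at `X`), and the IMAGE CLAUSE at the prime `(2)`:
every integral lift `G₁` of `L₂(f, α)` has a multiple `s·G₁ ∈ M` with `s ∉ (2)` (Thm. 16.6 (2) + Prop. 17.11 + the `2`-adic period
unit; equivalently `length_(2)(Λ/M) ≤ μ(G₁)`). SPAN-FREE (no Euler-system genuineness: B7′'s habitat «`ρ̄₂` not onto» has no
core-Theorem-A consumer) and `𝐇¹`-FREE (only the Coleman coordinates are kept): exactly what the `μ`-doors consume.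

* §1 `HasColemanHalfClassPackageAtTwo` (`@[conjecture]`, per datum) and `hasColemanHalfClassPackageAtTwo_iff` (`Iff.rfl`).
* §2 INSTANCES (kernel): `…_of_semilinear` (explicit `θ`-data), `…_of_linear` (a `Λ`-linear package = GEN 3's inline binder shape,
  `θ = 1`), `…_of_hasZetaColemanMuInputsAtTwo` (the lead's zeta package p678187), `…_of_zetaSemilinear` (w3's `θ`-keyed zeta data,
  span clause dropped), `…_of_zetaColemanMuIotaNegDiscAtTwo` (conjunct 1 of the PAIR child 24097, on «`ρ̄₂` onto, `Δ < 0`»).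
* §3 DOORS BY NAME: `mu_le_mu_…` / `katoMuPartAtTwo_…_of_integralRatio` / `…_irr` (one curve), and
  **`katoMuPartOff514_of_print_of_colemanHalfClassPackage`** / **`ordKatoMuPartOptimalAtTwo_of_print_of_colemanHalfClassPackage`**:
  B7′ = child 23921 ⟸ PRINT {Abbes–Ullmo, modularity, Lim 2017 Thm 3.5 at `2`, Ferrero–Washington} + ONE binder
  «`HasColemanHalfClassPackageAtTwo` at every lattice-optimal member of every non-CM good-ordinary class with `ρ̄₂` not onto».
* §4 `colemanHalfClassPackage_optimal_of_C3_of_reducibleOptimal` — GEN 3's two inline binders (p696823: `C₃` at the curve,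
  reducible at the optimal member) imply the one typed binder (odd-degree transport of «not onto», companion §4), so everything that
  fed p696823 feeds the new door.

What this is NOT: the package is NOT proved and NOT in print at `2` (memo tier; MEMO-7 (1.1)(h) reaches its content through the
relaxed-at-`∞` Selmer dual with GENUINE classes, F-27a through half classes); B7′ and the crux stay OPEN; no census number moves.

References: [Kato2004Asterisque] Thm 12.6 (p. 222), (14.9.3) (p. 240), Thm 16.6 (p. 271), Prop 17.11 (p. 277), §17.13 (pp. 279–280);
[MazurTateTeitelbaum1986Invent] §I.17; [GreenbergLNM1716] §1 p. 60, p. 170, Conj. 1.11; [AbbesUllmo1996] Thm A; [EdixhovenManin1991]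
Prop 2; [Lim2017FineSelmer] Thm 3.5; [FerreroWashington1979]; MEMO-7 (HOME); pen RC-373 (1), RC-383, RC-388 (α), RC-397 (2); tree
p678187, p690167, p693557, p693670, p694319, p695632, p696823 and the companion `…ColemanHalfClassSemilinear`.
-/

set_option autoImplicit false
set_option linter.dupNamespace false

noncomputable section

open scoped Classical MatrixGroups ModularForm NumberField
open CongruenceSubgroup WeierstrassCurve Field IsDedekindDomain NumberField
open Literature.NumberTheory.GaloisRepresentations
open Literature.NumberTheory.GaloisCohomology
open Literature.NumberTheory.EllipticCurves Literature.NumberTheory.EllipticCurves.ModularForms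
open Literature.NumberTheory.EllipticCurves.Kato2004
  Literature.NumberTheory.EllipticCurves.Kato2004.EulerSystemValues
open Literature.NumberTheory.EllipticCurves.Rank1Residual
open Literature.NumberTheory.EllipticCurves.Greenberg1999
open Literature.NumberTheory.IwasawaTheory
open Summit.BirchSwinnertonDyer.BirchSwinnertonDyer.Theorems.Rank1ResidualX1Defs
  Summit.BirchSwinnertonDyer.BirchSwinnertonDyer.Rank1Residual
  Summit.BirchSwinnertonDyer.BirchSwinnertonDyer.Rank1Residual.CoreAssembly
open Summit.BirchSwinnertonDyer.Rank1Residual Summit.BirchSwinnertonDyer.Rank1Residual.X5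
  Summit.BirchSwinnertonDyer.Rank1Residual.X1.MuLambda
open Summit.BirchSwinnertonDyer.BirchSwinnertonDyer.Theorems.OrdKatoOptimalAtTwo
  Summit.BirchSwinnertonDyer.BirchSwinnertonDyer.Theorems.OrdKatoIntAtTwo
open Summit.BirchSwinnertonDyer.BirchSwinnertonDyer.Theses.ByReductionTypeAtTwo

namespace Summit.BirchSwinnertonDyer.BirchSwinnertonDyer.Theorems.SteinbergFibreAtTwo

/-! ## §1 The Coleman half-class package at `2`, per datum (the ONE displayed definition) -/

/-- [MEMO tier, OPEN — a reading, nothing asserted] **The Coleman HALF-CLASS package at `p = 2` for ONE curve `W`, a form `f`,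
the cyclotomic `(κ, γ)` and dual data `D` (`X = X(E/ℚ_∞)`), `Y` (`X₀`).** There are a ring automorphism `θ` of `Λ = ℤ₂⟦T⟧`, an ideal
`P ⊆ Λ` (the Coleman image of `𝐇¹_loc ⧸ 𝐇¹_loc(F⁺)`, Prop. 17.11), a submodule `M ⊆ P` (the Coleman coordinates of the global
Iwasawa classes: Kato's zeta classes, Thm. 16.6, or — on a rectangular period lattice, `0 < Δ`, where Kato's classes are booked at
`2·L₂` — their halves; F-27a), a `θ`-SEMILINEAR `Λ`-map `τ : P → X` (the Poitou–Tate column map; honest keying `θ = ι`, the filed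
reading `θ = 1`) with `τ(M) = 0` and image `ker(π)` for the fine quotient `π : X ↠ X₀` ((14.9.3)), such that every `G₁ ∈ Λ` with
`ι G₁ = L₂(f, α)` has `s·G₁ ∈ M` for some `s ∉ (2)` (the image clause at the prime `(2)`: explicit reciprocity 16.6 (2), 17.11 and
the `2`-adic period unit). Span-free and `𝐇¹`-free: exactly the currency of the `μ`-doors (p693670, p694319 and their semilinear
twins). Supplied wherever the lead's zeta package `HasZetaColemanMuInputsAtTwo` or w3's `ι`-keyed zeta data hold (§2); on B7′'s
habitat («`ρ̄₂` not onto») NOT in print at `2`. NOT a Literature fact; nothing asserted.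
[cite: Kato2004Asterisque, Thm. 12.6 (p. 222), (14.9.3) (p. 240), Thm. 16.6 (p. 271), Prop. 17.11 (p. 277), §17.13 (pp. 279–280) (shape only; nothing asserted)]
[cite: MazurTateTeitelbaum1986Invent, Ch. I §17 (the involution; shape only)] -/
@[conjecture] def HasColemanHalfClassPackageAtTwo (W : WeierstrassCurve ℚ) [W.IsElliptic] [W.IsGloballyMinimal]
    {N : ℕ} (f : CuspForm (Gamma0 N) 2) (κ : ZpExtension ℚ 2) (γ : absoluteGaloisGroup ℚ)
    (D : W.SelmerDualData κ γ) (Y : W.FineSelmerDualData κ γ) : Prop :=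
  ∃ (θ : IwasawaAlgebra 2 ≃+* IwasawaAlgebra 2) (P : Submodule (IwasawaAlgebra 2) (IwasawaAlgebra 2))
    (M : Submodule (IwasawaAlgebra 2) P)
    (τ : P →ₛₗ[(θ : IwasawaAlgebra 2 →+* IwasawaAlgebra 2)] D.X) (π : D.X →ₗ[IwasawaAlgebra 2] Y.X),
    (∀ m ∈ M, τ m = 0) ∧ Function.Surjective π ∧ Function.Exact τ π ∧
    ∀ G₁ : IwasawaAlgebra 2, iwasawaToPowerSeries 2 G₁ = padicLFunction f (unitRoot W 2 : ℚ_[2]) →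
      ∃ s : IwasawaAlgebra 2, s ∉ IwasawaAlgebra.augIdealP 2 ∧ s * G₁ ∈ Submodule.map P.subtype M

section PerDatum

variable {W : WeierstrassCurve ℚ} [W.IsElliptic] [W.IsGloballyMinimal] {N : ℕ} {f : CuspForm (Gamma0 N) 2}
  {κ : ZpExtension ℚ 2} {γ : absoluteGaloisGroup ℚ} {D : W.SelmerDualData κ γ} {Y : W.FineSelmerDualData κ γ}

/-- `HasColemanHalfClassPackageAtTwo` unfolds to its displayed body. [folklore] -/
theorem hasColemanHalfClassPackageAtTwo_iff : HasColemanHalfClassPackageAtTwo W f κ γ D Y ↔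
    ∃ (θ : IwasawaAlgebra 2 ≃+* IwasawaAlgebra 2) (P : Submodule (IwasawaAlgebra 2) (IwasawaAlgebra 2))
      (M : Submodule (IwasawaAlgebra 2) P)
      (τ : P →ₛₗ[(θ : IwasawaAlgebra 2 →+* IwasawaAlgebra 2)] D.X) (π : D.X →ₗ[IwasawaAlgebra 2] Y.X),
      (∀ m ∈ M, τ m = 0) ∧ Function.Surjective π ∧ Function.Exact τ π ∧
      ∀ G₁ : IwasawaAlgebra 2, iwasawaToPowerSeries 2 G₁ = padicLFunction f (unitRoot W 2 : ℚ_[2]) →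
        ∃ s : IwasawaAlgebra 2, s ∉ IwasawaAlgebra.augIdealP 2 ∧ s * G₁ ∈ Submodule.map P.subtype M :=
  Iff.rfl

/-! ## §2 Instances: every Coleman package already in the tree supplies it -/

/-- **Constructor from explicit `θ`-semilinear data** (`θ` any ring automorphism of `Λ`; `θ = ι` is print's keying). [folklore] -/
theorem hasColemanHalfClassPackageAtTwo_of_semilinear (θ : IwasawaAlgebra 2 ≃+* IwasawaAlgebra 2)
    (P : Submodule (IwasawaAlgebra 2) (IwasawaAlgebra 2)) (M : Submodule (IwasawaAlgebra 2) P)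
    (τ : P →ₛₗ[(θ : IwasawaAlgebra 2 →+* IwasawaAlgebra 2)] D.X) (π : D.X →ₗ[IwasawaAlgebra 2] Y.X)
    (hτM : ∀ m ∈ M, τ m = 0) (hπs : Function.Surjective π) (hπ : Function.Exact τ π)
    (himg : ∀ G₁ : IwasawaAlgebra 2, iwasawaToPowerSeries 2 G₁ = padicLFunction f (unitRoot W 2 : ℚ_[2]) →
      ∃ s : IwasawaAlgebra 2, s ∉ IwasawaAlgebra.augIdealP 2 ∧ s * G₁ ∈ Submodule.map P.subtype M) :
    HasColemanHalfClassPackageAtTwo W f κ γ D Y :=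
  ⟨θ, P, M, τ, π, hτM, hπs, hπ, himg⟩

/-- **A `Λ`-LINEAR span-free Coleman package (GEN 3's inline binder shape, p693670/p694319/p696823) supplies the package** at
`θ = 1` (`RingEquiv.refl`; `Λ`-linear = `RingHom.id`-semilinear). [folklore] -/
theorem hasColemanHalfClassPackageAtTwo_of_linear
    (P : Submodule (IwasawaAlgebra 2) (IwasawaAlgebra 2)) (M : Submodule (IwasawaAlgebra 2) P)
    (τ : P →ₗ[IwasawaAlgebra 2] D.X) (π : D.X →ₗ[IwasawaAlgebra 2] Y.X)
    (hτM : ∀ m ∈ M, τ m = 0) (hπs : Function.Surjective π) (hπ : Function.Exact τ π)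
    (himg : ∀ G₁ : IwasawaAlgebra 2, iwasawaToPowerSeries 2 G₁ = padicLFunction f (unitRoot W 2 : ℚ_[2]) →
      ∃ s : IwasawaAlgebra 2, s ∉ IwasawaAlgebra.augIdealP 2 ∧ s * G₁ ∈ Submodule.map P.subtype M) :
    HasColemanHalfClassPackageAtTwo W f κ γ D Y :=
  ⟨RingEquiv.refl _, P, M,
    { toFun := τ, map_add' := fun x y => τ.map_add x y, map_smul' := fun r x => τ.map_smul r x },
    π, hτM, hπs, hπ, himg⟩

/-- **w3's `θ`-keyed ZETA data supply the package** (the per-datum body of F1μ⁺ι / F1μι⁻: pinned `𝐇¹` `I`, zeta submodule `Z`,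
ideal `P`, `Λ`-linear `ℓ : 𝐇¹ → P`, `θ`-semilinear `τ` killing `ℓ(Z)`, `π` exact after `τ`, image clause on `ℓ(Z)`): take
`M := ℓ(Z)`; the span clause over genuine Euler-system classes is NOT needed. [folklore] -/
theorem hasColemanHalfClassPackageAtTwo_of_zetaSemilinear
    [ContinuousSMul ℤ_[2] (W.tateModule 2)] [Module.Free ℤ_[2] (W.tateModule 2)] [Module.Finite ℤ_[2] (W.tateModule 2)]
    (θ : IwasawaAlgebra 2 ≃+* IwasawaAlgebra 2) (I : IwasawaH1Data W 2 κ γ) (Z : Submodule (IwasawaAlgebra 2) I.H)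
    (P : Submodule (IwasawaAlgebra 2) (IwasawaAlgebra 2)) (ℓ : I.H →ₗ[IwasawaAlgebra 2] P)
    (τ : P →ₛₗ[(θ : IwasawaAlgebra 2 →+* IwasawaAlgebra 2)] D.X) (π : D.X →ₗ[IwasawaAlgebra 2] Y.X)
    (hτℓ : ∀ z ∈ Z, τ (ℓ z) = 0) (hπs : Function.Surjective π) (hπ : Function.Exact τ π)
    (himg : ∀ G₁ : IwasawaAlgebra 2, iwasawaToPowerSeries 2 G₁ = padicLFunction f (unitRoot W 2 : ℚ_[2]) →
      ∃ s : IwasawaAlgebra 2, s ∉ IwasawaAlgebra.augIdealP 2 ∧ s * G₁ ∈ Submodule.map (P.subtype ∘ₗ ℓ) Z) :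
    HasColemanHalfClassPackageAtTwo W f κ γ D Y := by
  refine ⟨θ, P, Submodule.map ℓ Z, τ, π, ?_, hπs, hπ, fun G₁ hG₁ ↦ ?_⟩
  · rintro _ ⟨z, hz, rfl⟩
    exact hτℓ z hz
  · obtain ⟨s, hs, hsG⟩ := himg G₁ hG₁
    exact ⟨s, hs, by rw [← Submodule.map_comp]; exact hsG⟩

/-- **The lead's zeta package `HasZetaColemanMuInputsAtTwo` (p678187; child F1μ of the crux) supplies the package** (`θ = 1`,
`M := ℓ(Z)`, span clause discarded — GEN 3's `colemanMuPackage_of_hasZetaColemanMuInputsAtTwo`). [folklore] -/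
theorem hasColemanHalfClassPackageAtTwo_of_hasZetaColemanMuInputsAtTwo
    [ContinuousSMul ℤ_[2] (W.tateModule 2)] [Module.Free ℤ_[2] (W.tateModule 2)] [Module.Finite ℤ_[2] (W.tateModule 2)]
    {hκ : κ.IsCyclotomic} (h : HasZetaColemanMuInputsAtTwo W f κ γ hκ D Y) :
    HasColemanHalfClassPackageAtTwo W f κ γ D Y := by
  obtain ⟨P, M, τ, π, hτM, hπs, hπ, himg⟩ := colemanMuPackage_of_hasZetaColemanMuInputsAtTwo h
  exact hasColemanHalfClassPackageAtTwo_of_linear P M τ π hτM hπs hπ himg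

end PerDatum

/-- **Conjunct 1 of the PAIR child 24097 — F1μι⁻ `ZetaColemanMuIotaNegDiscAtTwo` (lead p693557; `ι`-keyed zeta package on
«good ordinary at `2`, `ρ̄₂` onto, `Δ < 0`») — supplies the package on its habitat** (`θ = ι`, span clause dropped). So wherever the
crux's F1 reading holds, so does this one; the converse is not claimed. [folklore] -/
theorem hasColemanHalfClassPackageAtTwo_of_zetaColemanMuIotaNegDiscAtTwo (hF : ZetaColemanMuIotaNegDiscAtTwo)
    (W : WeierstrassCurve ℚ) [W.IsElliptic] [W.IsGloballyMinimal] (hord : IsOrdinaryAt W 2)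
    (h2 : W.HasSurjectiveModNGaloisRep 2) (hΔ : W.Δ < 0) {N : ℕ} [NeZero N] (f : CuspForm (Gamma0 N) 2)
    (hf : IsNewformOf W f) (κ : ZpExtension ℚ 2) (γ : absoluteGaloisGroup ℚ) (hκ : κ.IsCyclotomic)
    (hγ : κ.IsTopGenerator γ) (hγ' : IsCyclotomicVariable 2 γ) (D : W.SelmerDualData κ γ) (Y : W.FineSelmerDualData κ γ) :
    HasColemanHalfClassPackageAtTwo W f κ γ D Y := by
  haveI : ContinuousSMul ℤ_[2] (W.tateModule 2) := TateModule.continuousSMul_padicInt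
  haveI : Module.Free ℤ_[2] (W.tateModule 2) := W.module_free_tateModule_holds 2
  haveI : Module.Finite ℤ_[2] (W.tateModule 2) := W.module_finite_tateModule_holds 2
  obtain ⟨I, Z, P, ℓ, τ, π, -, hτℓ, hπs, hπ, himg⟩ := hF W f κ γ hκ hord h2 hΔ hγ hγ' hf D Y
  exact hasColemanHalfClassPackageAtTwo_of_zetaSemilinear _ I Z P ℓ τ π hτℓ hπs hπ himg

/-! ## §3 The doors BY NAME -/

section Doors

variable {W : WeierstrassCurve ℚ} [W.IsElliptic] [W.IsGloballyMinimal] {N : ℕ} {f : CuspForm (Gamma0 N) 2}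
  {κ : ZpExtension ℚ 2} {γ : absoluteGaloisGroup ℚ} {D : W.SelmerDualData κ γ} {Y : W.FineSelmerDualData κ γ}

/-- **`μ`-door with slack, by name**: the package for `(D, Y)`, `ι G = L₂(f, α)` with `G ≠ 0`, and `Sel₀(E/ℚ_∞)[2]` finite ⇒
`μ(X) ≤ μ(G)` (companion §2). [cite: Kato2004Asterisque, §17.13 (pp. 279–280) (shape)] [cite: Washington1997, §13.2] -/
theorem mu_le_mu_of_hasColemanHalfClassPackageAtTwo (hκ : κ.IsCyclotomic) (hγ : κ.IsTopGenerator γ)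
    (h : HasColemanHalfClassPackageAtTwo W f κ γ D Y) {G : IwasawaAlgebra 2} (hG : G ≠ 0)
    (hGL : iwasawaToPowerSeries 2 G = padicLFunction f (unitRoot W 2 : ℚ_[2]))
    (hfin : Set.Finite {s : W.fineSelmerInfty κ | 2 • s = 0}) : D.mu ≤ mu G := by
  obtain ⟨θ, P, M, τ, π, hτM, hπs, hπ, himg⟩ := h
  exact mu_le_mu_of_unitMultiple_of_exact_semilinear_of_finite_fineSelmer_pTorsion hκ hγ hG θ P M τ π hτM hπs hπ
    (himg G hGL) hfin

/-- **`μ = 0` door, by name**: the package, `ι G₁ = L₂(f, α)` with `G₁ ∉ (2)` (an analytic unit coefficient), `Sel₀(E/ℚ_∞)[2]`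
finite ⇒ `μ(X) = 0` (companion §2). [cite: Kato2004Asterisque, §17.13 (pp. 279–280) (shape)] [cite: GreenbergLNM1716, §1 p. 60] -/
theorem mu_eq_zero_of_hasColemanHalfClassPackageAtTwo (hκ : κ.IsCyclotomic) (hγ : κ.IsTopGenerator γ)
    (h : HasColemanHalfClassPackageAtTwo W f κ γ D Y) {G₁ : IwasawaAlgebra 2} (hμL : G₁ ∉ IwasawaAlgebra.augIdealP 2)
    (hGL : iwasawaToPowerSeries 2 G₁ = padicLFunction f (unitRoot W 2 : ℚ_[2]))
    (hfin : Set.Finite {s : W.fineSelmerInfty κ | 2 • s = 0}) : D.mu = 0 := by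
  obtain ⟨θ, P, M, τ, π, hτM, hπs, hπ, himg⟩ := h
  exact mu_eq_zero_of_unitMultiple_of_exact_semilinear_of_finite_fineSelmer_pTorsion hκ hγ hμL θ P M τ π hτM hπs hπ
    (himg G₁ hGL) hfin

end Doors

/-- **`X5.O1.KatoMuPartAtTwo W′` at ONE curve, ANY image, by name**: the package for every newform of `W′` and all data,
«`Sel₀(W′/ℚ_∞)[2]` finite» for every cyclotomic `κ`, «`0 ≤ ord₂ ϖ`» for every newform/Néron ratio (companion §3).
[cite: GreenbergLNM1716, §1 p. 60, p. 170 (shape)] [cite: Kato2004Asterisque, §17.13 (pp. 279–280)] -/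
theorem katoMuPartAtTwo_of_hasColemanHalfClassPackageAtTwo_of_finite_fineSelmer_of_integralRatio (W' : WeierstrassCurve ℚ)
    [W'.IsElliptic] [W'.IsGloballyMinimal]
    (hC : ∀ {N : ℕ} [NeZero N] (f : CuspForm (Gamma0 N) 2) (κ : ZpExtension ℚ 2) (γ : absoluteGaloisGroup ℚ),
      κ.IsCyclotomic → κ.IsTopGenerator γ → IsCyclotomicVariable 2 γ → IsNewformOf W' f →
      ∀ (D : W'.SelmerDualData κ γ) (Y : W'.FineSelmerDualData κ γ), HasColemanHalfClassPackageAtTwo W' f κ γ D Y)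
    (hA : ∀ κ : ZpExtension ℚ 2, κ.IsCyclotomic → Set.Finite {s : W'.fineSelmerInfty κ | 2 • s = 0})
    (hϖ : ∀ {N : ℕ} [NeZero N] (f : CuspForm (Gamma0 N) 2), IsNewformOf W' f →
      ∀ ϖ : ℚ, (ϖ : ℝ) * W'.realPeriodRat = plusPeriod f → 0 ≤ padicValRat 2 ϖ) :
    O1.KatoMuPartAtTwo W' :=
  katoMuPartAtTwo_of_colemanPackageSemilinear_of_finite_fineSelmer_of_integralRatio W'
    (fun f κ γ hκ hγ hγ' hf D Y ↦ hC f κ γ hκ hγ hγ' hf D Y) hA hϖ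

/-- **`X5.O1.KatoMuPartAtTwo W` at ONE curve with `E[2]` IRREDUCIBLE, by name**: the package for all data and «`Sel₀(W/ℚ_∞)[2]`
finite» (companion §3; analytic `μ₂ = 0` p642753). [cite: GreenbergLNM1716, §1 p. 60, Conj. 1.11 (shape)] -/
theorem katoMuPartAtTwo_of_hasColemanHalfClassPackageAtTwo_of_finite_fineSelmer_irr (W : WeierstrassCurve ℚ) [W.IsElliptic]
    [W.IsGloballyMinimal] (hirr : W.HasIrreducibleModPGaloisRep 2)
    (hCW : ∀ {N : ℕ} [NeZero N] (f : CuspForm (Gamma0 N) 2) (κ : ZpExtension ℚ 2) (γ : absoluteGaloisGroup ℚ),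
      κ.IsCyclotomic → κ.IsTopGenerator γ → IsCyclotomicVariable 2 γ → IsNewformOf W f →
      ∀ (D : W.SelmerDualData κ γ) (Y : W.FineSelmerDualData κ γ), HasColemanHalfClassPackageAtTwo W f κ γ D Y)
    (hAW : ∀ κ : ZpExtension ℚ 2, κ.IsCyclotomic → Set.Finite {s : W.fineSelmerInfty κ | 2 • s = 0}) :
    O1.KatoMuPartAtTwo W :=
  katoMuPartAtTwo_of_colemanPackageSemilinear_of_finite_fineSelmer_irr W hirr
    (fun f κ γ hκ hγ hγ' hf D Y ↦ hCW f κ γ hκ hγ hγ' hf D Y) hAW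

/-- **B7′ `KatoMuPartOff514AtOptimalMemberOfNotSurjectiveTwo` (child stmt-BirchSwinnertonDyer-23921) BY NAME ⟸ FOUR PRINT FACTS +
ONE TYPED BINDER** — (Col½-opt): `HasColemanHalfClassPackageAtTwo W₀ f κ γ D Y` for every non-CM globally minimal `W`, good
ordinary at `2`, `ρ̄_{W,2}` NOT onto, every isogenous lattice-optimal `W₀` (datum `D₀`, `Λ_{W₀} = c₀·Λ_f`), every newform of `W₀`,
all cyclotomic and dual data. Print facts by name: Abbes–Ullmo, modularity, Lim 2017 Thm 3.5 at `2`, Ferrero–Washington (the last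
two give statement (A₂) at `W₀`, companion §4). Uniform in the image; conditional; nothing closed; the binder is memo tier.
[cite: AbbesUllmo1996, Thm. A] [cite: EdixhovenManin1991, Prop. 2] [cite: Lim2017FineSelmer, §3 Thm. 3.5 and Lemma 3.2]
[cite: FerreroWashington1979, main theorem] [cite: Kato2004Asterisque, §17.13 (pp. 279–280) (shape; nothing asserted)] -/
theorem katoMuPartOff514_of_print_of_colemanHalfClassPackage
    (hAU : abbesUllmo_not_dvd_maninConstant_of_not_dvd_level) (hMod : nonempty_modularParametrizationData)
    (hLim2 : Lim2017.thm35_at_two_fineSelmerDual_moduleFinite_of_classicalMuVanishes_of_le_divisionField_four)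
    (hFW : ferreroWashington1979_classicalMuVanishes)
    (hCol : ∀ (W : WeierstrassCurve ℚ) [W.IsElliptic] [W.IsGloballyMinimal],
      ¬ W.HasCM → GoodOrd W 2 → ¬ W.HasSurjectiveModNGaloisRep 2 →
      ∀ (W₀ : WeierstrassCurve ℚ) [W₀.IsElliptic] [W₀.IsGloballyMinimal] {N₀ : ℕ} [NeZero N₀]
        (D₀ : ModularParametrizationData W₀ N₀), WeierstrassCurve.IsIsogenous W W₀ →
        (∀ z ∈ D₀.L.lattice, ∃ w ∈ periodLattice D₀.f, z = D₀.c * w) →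
      ∀ {N : ℕ} [NeZero N] (f : CuspForm (Gamma0 N) 2) (κ : ZpExtension ℚ 2) (γ : absoluteGaloisGroup ℚ),
        κ.IsCyclotomic → κ.IsTopGenerator γ → IsCyclotomicVariable 2 γ → IsNewformOf W₀ f →
        ∀ (D : W₀.SelmerDualData κ γ) (Y : W₀.FineSelmerDualData κ γ), HasColemanHalfClassPackageAtTwo W₀ f κ γ D Y) :
    KatoMuPartOff514AtOptimalMemberOfNotSurjectiveTwo :=
  katoMuPartOff514_of_print_of_colemanPackageSemilinear_optimal hAU hMod hLim2 hFW
    (fun W _ _ hcm hgo hns W₀ _ _ _ _ D₀ hiso hopt _ _ f κ γ hκ hγ hγ' hf D Y ↦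
      hCol W hcm hgo hns W₀ D₀ hiso hopt f κ γ hκ hγ hγ' hf D Y)

/-- **The route's child `OrdKatoMuPartOptimalAtTwo` (stmt-BirchSwinnertonDyer-23921, text = B7′ verbatim) BY NAME from the four
print facts and the one typed binder (Col½-opt).** Conditional; the item is NOT closed by this; nothing asserted.
[cite: AbbesUllmo1996, Thm. A] [cite: Lim2017FineSelmer, §3 Thm. 3.5 and Lemma 3.2] [cite: FerreroWashington1979, main theorem] -/
theorem ordKatoMuPartOptimalAtTwo_of_print_of_colemanHalfClassPackage
    (hAU : abbesUllmo_not_dvd_maninConstant_of_not_dvd_level) (hMod : nonempty_modularParametrizationData)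
    (hLim2 : Lim2017.thm35_at_two_fineSelmerDual_moduleFinite_of_classicalMuVanishes_of_le_divisionField_four)
    (hFW : ferreroWashington1979_classicalMuVanishes)
    (hCol : ∀ (W : WeierstrassCurve ℚ) [W.IsElliptic] [W.IsGloballyMinimal],
      ¬ W.HasCM → GoodOrd W 2 → ¬ W.HasSurjectiveModNGaloisRep 2 →
      ∀ (W₀ : WeierstrassCurve ℚ) [W₀.IsElliptic] [W₀.IsGloballyMinimal] {N₀ : ℕ} [NeZero N₀]
        (D₀ : ModularParametrizationData W₀ N₀), WeierstrassCurve.IsIsogenous W W₀ →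
        (∀ z ∈ D₀.L.lattice, ∃ w ∈ periodLattice D₀.f, z = D₀.c * w) →
      ∀ {N : ℕ} [NeZero N] (f : CuspForm (Gamma0 N) 2) (κ : ZpExtension ℚ 2) (γ : absoluteGaloisGroup ℚ),
        κ.IsCyclotomic → κ.IsTopGenerator γ → IsCyclotomicVariable 2 γ → IsNewformOf W₀ f →
        ∀ (D : W₀.SelmerDualData κ γ) (Y : W₀.FineSelmerDualData κ γ), HasColemanHalfClassPackageAtTwo W₀ f κ γ D Y) :
    OrdKatoMuPartOptimalAtTwo :=
  katoMuPartOff514_of_print_of_colemanHalfClassPackage hAU hMod hLim2 hFW hCol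

/-! ## §4 GEN 3's two inline binders imply the one typed binder -/

/-- **GEN 3's two `Λ`-linear inline binders (p696823: (Colμ-C₃) at the curve on «ordinary at `2`, `E[2]` irreducible, `ρ̄₂` not
onto»; (Colμ-opt-red) at every lattice-optimal member of a non-CM good-ordinary `E[2]`-REDUCIBLE class) imply the ONE typed binder
(Col½-opt)** — so every supplier of p696823's inputs feeds the new door. Irreducible `W`: the optimal member `W₀` is good ordinary
(`goodOrd_two_of_isIsogenous`), `E[2]`-irreducible (`Rank1Residual.not_hasIrreducibleModPGaloisRep_of_isIsogenous` on the
symmetric isogeny) and not onto (companion `not_hasSurjectiveModNGaloisRep_two_of_isIsogenous`, odd-degree transport), so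
(Colμ-C₃) applies AT `W₀`; reducible `W`: (Colμ-opt-red) verbatim. [folklore] -/
theorem colemanHalfClassPackage_optimal_of_C3_of_reducibleOptimal
    (hC3 : ∀ (W : WeierstrassCurve ℚ) [W.IsElliptic] [W.IsGloballyMinimal] {N : ℕ} [NeZero N]
      (f : CuspForm (Gamma0 N) 2) (κ : ZpExtension ℚ 2) (γ : absoluteGaloisGroup ℚ),
      κ.IsCyclotomic → IsOrdinaryAt W 2 → W.HasIrreducibleModPGaloisRep 2 → ¬ W.HasSurjectiveModNGaloisRep 2 →
      κ.IsTopGenerator γ → IsCyclotomicVariable 2 γ → IsNewformOf W f →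
      ∀ (D : W.SelmerDualData κ γ) (Y : W.FineSelmerDualData κ γ),
        ∃ (P : Submodule (IwasawaAlgebra 2) (IwasawaAlgebra 2)) (M : Submodule (IwasawaAlgebra 2) P)
          (τ : P →ₗ[IwasawaAlgebra 2] D.X) (π : D.X →ₗ[IwasawaAlgebra 2] Y.X),
          (∀ m ∈ M, τ m = 0) ∧ Function.Surjective π ∧ Function.Exact τ π ∧
          ∀ G₁ : IwasawaAlgebra 2, iwasawaToPowerSeries 2 G₁ = padicLFunction f (unitRoot W 2 : ℚ_[2]) →
            ∃ s : IwasawaAlgebra 2, s ∉ IwasawaAlgebra.augIdealP 2 ∧ s * G₁ ∈ Submodule.map P.subtype M)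
    (hCred : ∀ (W : WeierstrassCurve ℚ) [W.IsElliptic] [W.IsGloballyMinimal],
      ¬ W.HasCM → GoodOrd W 2 → ¬ W.HasIrreducibleModPGaloisRep 2 →
      ∀ (W₀ : WeierstrassCurve ℚ) [W₀.IsElliptic] [W₀.IsGloballyMinimal] {N₀ : ℕ} [NeZero N₀]
        (D₀ : ModularParametrizationData W₀ N₀), WeierstrassCurve.IsIsogenous W W₀ →
        (∀ z ∈ D₀.L.lattice, ∃ w ∈ periodLattice D₀.f, z = D₀.c * w) →
      ∀ {N : ℕ} [NeZero N] (f : CuspForm (Gamma0 N) 2) (κ : ZpExtension ℚ 2) (γ : absoluteGaloisGroup ℚ),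
        κ.IsCyclotomic → κ.IsTopGenerator γ → IsCyclotomicVariable 2 γ → IsNewformOf W₀ f →
        ∀ (D : W₀.SelmerDualData κ γ) (Y : W₀.FineSelmerDualData κ γ),
          ∃ (P : Submodule (IwasawaAlgebra 2) (IwasawaAlgebra 2)) (M : Submodule (IwasawaAlgebra 2) P)
            (τ : P →ₗ[IwasawaAlgebra 2] D.X) (π : D.X →ₗ[IwasawaAlgebra 2] Y.X),
            (∀ m ∈ M, τ m = 0) ∧ Function.Surjective π ∧ Function.Exact τ π ∧
            ∀ G₁ : IwasawaAlgebra 2, iwasawaToPowerSeries 2 G₁ = padicLFunction f (unitRoot W₀ 2 : ℚ_[2]) →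
              ∃ s : IwasawaAlgebra 2, s ∉ IwasawaAlgebra.augIdealP 2 ∧ s * G₁ ∈ Submodule.map P.subtype M) :
    ∀ (W : WeierstrassCurve ℚ) [W.IsElliptic] [W.IsGloballyMinimal],
      ¬ W.HasCM → GoodOrd W 2 → ¬ W.HasSurjectiveModNGaloisRep 2 →
      ∀ (W₀ : WeierstrassCurve ℚ) [W₀.IsElliptic] [W₀.IsGloballyMinimal] {N₀ : ℕ} [NeZero N₀]
        (D₀ : ModularParametrizationData W₀ N₀), WeierstrassCurve.IsIsogenous W W₀ →
        (∀ z ∈ D₀.L.lattice, ∃ w ∈ periodLattice D₀.f, z = D₀.c * w) →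
      ∀ {N : ℕ} [NeZero N] (f : CuspForm (Gamma0 N) 2) (κ : ZpExtension ℚ 2) (γ : absoluteGaloisGroup ℚ),
        κ.IsCyclotomic → κ.IsTopGenerator γ → IsCyclotomicVariable 2 γ → IsNewformOf W₀ f →
        ∀ (D : W₀.SelmerDualData κ γ) (Y : W₀.FineSelmerDualData κ γ), HasColemanHalfClassPackageAtTwo W₀ f κ γ D Y := by
  intro W _ _ hcm hgo hns W₀ _ _ N₀ _ D₀ hiso hopt N _ f κ γ hκ hγ hγ' hf D Y
  by_cases hirr : W.HasIrreducibleModPGaloisRep 2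
  · -- `C₃` class: key (Colμ-C₃) at the optimal member `W₀`
    have hgo₀ : GoodOrd W₀ 2 := goodOrd_two_of_isIsogenous W hiso hgo
    have hirr₀ : W₀.HasIrreducibleModPGaloisRep 2 := by
      by_contra hred₀
      exact Rank1Residual.not_hasIrreducibleModPGaloisRep_of_isIsogenous hiso.symm_of_charZero hred₀ hirr
    have hns₀ : ¬ W₀.HasSurjectiveModNGaloisRep 2 := not_hasSurjectiveModNGaloisRep_two_of_isIsogenous W hns hiso
    obtain ⟨P, M, τ, π, hτM, hπs, hπ, himg⟩ := hC3 W₀ f κ γ hκ ⟨hgo₀.1, hgo₀.2⟩ hirr₀ hns₀ hγ hγ' hf D Y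
    exact hasColemanHalfClassPackageAtTwo_of_linear P M τ π hτM hπs hπ himg
  · obtain ⟨P, M, τ, π, hτM, hπs, hπ, himg⟩ := hCred W hcm hgo hirr W₀ D₀ hiso hopt f κ γ hκ hγ hγ' hf D Y
    exact hasColemanHalfClassPackageAtTwo_of_linear P M τ π hτM hπs hπ himg

end Summit.BirchSwinnertonDyer.BirchSwinnertonDyer.Theorems.SteinbergFibreAtTwo

end
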